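import Literature.NumberTheory.PAdicHodge.AinfRamifiedTopology
import Literature.NumberTheory.PAdicHodge.AinfFormalGroupPoints
import HarnessLib

/-!
# Points of formal groups with values in `A_inf(𝒪) = 𝔸_inf(F)[ϖ]`: evaluation of power series on
# `𝔫_𝒪 = θ_𝒪⁻¹(𝔪_{ℂ_F})`, compatibility with `θ_𝒪` and `Γ_F`, the congruence lemma, and `𝒪_D`-coefficients

Topic `Literature/NumberTheory/PAdicHodge`; the ramified twin of `AinfFormalGroupPoints` (case `𝒪 = ℤ_p`), sequel of
`AinfRamifiedTopology` (`AinfRamTop D`, `θ_𝒪`, `Γ_F`, `𝔫_𝒪`). A formal group law `𝔉` with coefficients in a (discretely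
topologised) ring `A` mapping to `A_inf(𝒪)` — fixed by `Γ_F` and compatible with `θ_𝒪` (e.g. `ℤ`, `ℤ_p`, and now the
coefficient ring `𝒪_D = ℤ_p[ϖ]` of the Eisenstein root datum, §6) — is evaluated at elements of the closed nil ideal
`𝔫_𝒪 ⊂ A_inf(𝒪)` (tree `AinfRamTop.nilTheta`, `LubinTate.evalPt` / `addPt`), making `𝔉(𝔫_𝒪)` a monoid mapping onto
`𝔉(𝔪_{ℂ_F})` by `θ_𝒪` and acted on by `Γ_F`: the setting of Fontaine's and Colmez's `p`-adic periods of formal groups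
over the RAMIFIED base `𝒪`.

* §4 compatibilities: `θ_𝒪(f(x)) = f(θ_𝒪 x)` (`theta_aeval`, `theta_evalPt`, `theta_addPt`) and `σ(f(x)) = f(σ x)` for
  `Γ_F`-invariant coefficients (`gal_aeval`, `gal_evalPt`, `gal_addPt`).
* §5 the congruence lemma `x ≡ y (mod J) ⇒ f(x) ≡ f(y) (mod J)` for a CLOSED ideal `J` of `A_inf(𝒪)`
  (`aeval_sub_aeval_mem`, `evalPt_sub_evalPt_mem`, `addPt_sub_addPt_mem`).
* §6 **the discrete coefficient ring `𝒪_D`** (`EisensteinRoot.CoeffDisc D`, a synonym of `𝒪_D = ℤ_p[X]/(f)` with the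
  discrete uniformity) as an algebra over which BOTH `A_inf(𝒪)` (via `coeffHom`) and `𝒪_{ℂ_F}` (via `𝒪_D → F ⊆ ℂ_F`)
  are continuous algebras, with the two compatibilities `θ_𝒪 ∘ (𝒪_D → A_inf(𝒪)) = (𝒪_D → 𝒪_{ℂ_F})`
  (`theta_algebraMap_coeffDisc`) and `σ|_{𝒪_D} = id` (`gal_algebraMap_coeffDisc`) — the hypotheses `hA`, `hσ` of
  §4 DISCHARGED for `𝒪_D`-coefficients.

Definitions (reviewed): `AinfRamTop.thetaAlgHom`, `AinfRamTop.galAlgHom`, `EisensteinRoot.CoeffDisc` (+ `.of`, `.toIntC`)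
and the uniform / algebra instances on the NEW types `CoeffDisc D`, `AinfRamTop D`. No named facts, no `sorry`.
Infrastructure for hDR over a ramified base; nothing about elliptic curves is proved here.

## References
* J.-P. Serre, *Local class field theory* (Cassels–Fröhlich Ch. VI) §3.2: points of a formal group with values in a
  complete ring. [CasselsFrohlichANT1967]
* J.-M. Fontaine, *Le corps des périodes p-adiques*, Astérisque 223 (1994), Exp. II §1.2–§1.3. [FontaineAsterisque223III]
* L. Fargues, J.-M. Fontaine, Astérisque 406 (2018), §1.2, §2.2. [FarguesFontaine2018]
-/

noncomputable section

open Ideal WittVector MvPowerSeries Field ValuativeRel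

namespace Literature.NumberTheory.PAdicHodge

open Literature.NumberTheory.GaloisRepresentations
open Literature.NumberTheory.GaloisRepresentations.IsNonarchimedeanLocalField
open Literature.NumberTheory.GaloisRepresentations.LubinTate

variable {F : Type} [Field F] [ValuativeRel F] [TopologicalSpace F] [IsNonarchimedeanLocalField F] [CharZero F]
  {p : ℕ} [Fact p.Prime] [Fact (¬ IsUnit (p : integerC F))]
  [IsAdicComplete (Ideal.span {(p : integerC F)}) (integerC F)] {hp : valuation F p < 1} (D : EisensteinRoot F p hp)

/-! ## §4 Evaluation of power series on `𝔫_𝒪`: compatibility with `θ_𝒪` and with `Γ_F` -/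

namespace AinfRamTop

variable {D}

section EvalTheta

variable {A : Type*} [CommRing A] [UniformSpace A] [DiscreteUniformity A]
  [Algebra A (AinfRamTop D)] [ContinuousSMul A (AinfRamTop D)] [Algebra A (CBall F)] [ContinuousSMul A (CBall F)]

/-- `θ` as an `A`-algebra homomorphism, for a coefficient ring `A` mapping compatibly to `𝔸_inf` and `𝒪_{ℂ_F}`.
[folklore] -/
def thetaAlgHom (hA : ∀ a : A, theta D (algebraMap A (AinfRamTop D) a) = algebraMap A (CBall F) a) :
    AinfRamTop D →ₐ[A] CBall F :=
  { theta D with commutes' := hA }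

omit [UniformSpace A] [DiscreteUniformity A] [ContinuousSMul A (AinfRamTop D)]
  [ContinuousSMul A (CBall F)] in
/-- Unfolding `thetaAlgHom`. [cite: FontaineAsterisque223III, Exp. II §1.2.2] -/
@[simp] theorem thetaAlgHom_apply (hA : ∀ a : A, theta D (algebraMap A (AinfRamTop D) a) = algebraMap A (CBall F) a)
    (z : AinfRamTop D) : thetaAlgHom hA z = theta D z := rfl

/-- **`θ` commutes with evaluation**: `θ(f(x)) = f(θ(x))` for a power series `f` over `A` and a topologically
nilpotent family `x` in `𝔸_inf` (Mathlib `MvPowerSeries.comp_aeval`, `θ` continuous). [cite: CasselsFrohlichANT1967, Ch. VI §3.2] -/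
theorem theta_aeval (hA : ∀ a : A, theta D (algebraMap A (AinfRamTop D) a) = algebraMap A (CBall F) a)
    {ι : Type*} {x : ι → AinfRamTop D} (hx : HasEval x) (f : MvPowerSeries ι A) :
    theta D (aeval hx f) = aeval (hx.map (φ := (thetaAlgHom hA : AinfRamTop D →+* CBall F)) continuous_theta) f := by
  have h := MvPowerSeries.comp_aeval hx (ε := thetaAlgHom hA) continuous_theta
  exact AlgHom.congr_fun h f

/-- **`θ : 𝔉(𝔫) → 𝔉(𝔪_{ℂ_F})` on evaluations**: `θ(f(x)) = f(θ x)` as points. [cite: CasselsFrohlichANT1967, Ch. VI §3.2] -/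
theorem theta_evalPt {hθ : Function.Surjective (fontaineTheta (integerC F) p)}
    (hA : ∀ a : A, theta D (algebraMap A (AinfRamTop D) a) = algebraMap A (CBall F) a)
    {ι : Type*} [Finite ι] (f : MvPowerSeries ι A) (hf : f.constantCoeff = 0)
    (x : ι → (nilTheta D hθ).toIdeal) (y : ι → (maxNilIdealC F).toIdeal)
    (hxy : ∀ i, theta D (x i : AinfRamTop D) = y i) :
    theta D (evalPt (nilTheta D hθ) f hf x : AinfRamTop D) = (evalPt (maxNilIdealC F) f hf y : CBall F) := by
  rw [coe_evalPt, coe_evalPt, theta_aeval hA ((nilTheta D hθ).hasEval x) f]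
  exact aeval_congr_point _ _ (funext fun i => hxy i) f

/-- **`θ` is a homomorphism of formal-group points**: `θ(x +_𝔉 y) = θ(x) +_𝔉 θ(y)` for every formal group law
`𝔉` over `A`. [cite: CasselsFrohlichANT1967, Ch. VI §3.2] -/
theorem theta_addPt {hθ : Function.Surjective (fontaineTheta (integerC F) p)}
    (hA : ∀ a : A, theta D (algebraMap A (AinfRamTop D) a) = algebraMap A (CBall F) a)
    (G : FormalGroup A) (x y : (nilTheta D hθ).toIdeal) :
    theta D (addPt (nilTheta D hθ) G x y : AinfRamTop D) =
      (addPt (maxNilIdealC F) G ⟨theta D x, theta_mem_maxNilIdealC x.2⟩ ⟨theta D y, theta_mem_maxNilIdealC y.2⟩ :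
        CBall F) :=
  theta_evalPt hA G.toPowerSeries G.zero_constantCoeff ![x, y]
    ![⟨theta D x, theta_mem_maxNilIdealC x.2⟩, ⟨theta D y, theta_mem_maxNilIdealC y.2⟩]
    fun i => by fin_cases i <;> rfl

end EvalTheta

section EvalGal

variable {A : Type*} [CommRing A] [UniformSpace A] [DiscreteUniformity A]
  [Algebra A (AinfRamTop D)] [ContinuousSMul A (AinfRamTop D)]

/-- `σ ∈ Γ_F` as an `A`-algebra endomorphism of `AinfTop`, for coefficients fixed by `σ`. [folklore] -/
def galAlgHom (σ : absoluteGaloisGroup F) (hσ : ∀ a : A, gal D σ (algebraMap A (AinfRamTop D) a) = algebraMap A (AinfRamTop D) a) :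
    AinfRamTop D →ₐ[A] AinfRamTop D :=
  { gal D σ with commutes' := hσ }

omit [IsAdicComplete (Ideal.span {(p : integerC F)}) (integerC F)] [UniformSpace A]
  [DiscreteUniformity A] [ContinuousSMul A (AinfRamTop D)] in
/-- Unfolding `galAlgHom`. [cite: FontaineAsterisque223III, Exp. II §1.2] -/
@[simp] theorem galAlgHom_apply (σ : absoluteGaloisGroup F)
    (hσ : ∀ a : A, gal D σ (algebraMap A (AinfRamTop D) a) = algebraMap A (AinfRamTop D) a) (z : AinfRamTop D) :
    galAlgHom σ hσ z = gal D σ z := rfl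

/-- **`Γ_F` commutes with evaluation**: `σ(f(x)) = f(σ x)` when `σ` fixes the coefficients.
[cite: FontaineAsterisque223III, Exp. II §1.2] -/
theorem gal_aeval (σ : absoluteGaloisGroup F)
    (hσ : ∀ a : A, gal D σ (algebraMap A (AinfRamTop D) a) = algebraMap A (AinfRamTop D) a)
    {ι : Type*} {x : ι → AinfRamTop D} (hx : HasEval x) (f : MvPowerSeries ι A) :
    gal D σ (aeval hx f) = aeval (hx.map (φ := (galAlgHom σ hσ : AinfRamTop D →+* AinfRamTop D)) (continuous_gal σ)) f := by
  have h := MvPowerSeries.comp_aeval hx (ε := galAlgHom σ hσ) (continuous_gal σ)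
  exact AlgHom.congr_fun h f

/-- `σ(f(x)) = f(σ x)` as points of `𝔫`. [cite: FontaineAsterisque223III, Exp. II §1.2] -/
theorem gal_evalPt {hθ : Function.Surjective (fontaineTheta (integerC F) p)} (σ : absoluteGaloisGroup F)
    (hσ : ∀ a : A, gal D σ (algebraMap A (AinfRamTop D) a) = algebraMap A (AinfRamTop D) a)
    {ι : Type*} [Finite ι] (f : MvPowerSeries ι A) (hf : f.constantCoeff = 0)
    (x y : ι → (nilTheta D hθ).toIdeal) (hxy : ∀ i, gal D σ (x i : AinfRamTop D) = y i) :
    gal D σ (evalPt (nilTheta D hθ) f hf x : AinfRamTop D) = (evalPt (nilTheta D hθ) f hf y : AinfRamTop D) := by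
  rw [coe_evalPt, coe_evalPt, gal_aeval σ hσ ((nilTheta D hθ).hasEval x) f]
  exact aeval_congr_point _ _ (funext fun i => hxy i) f

/-- **`Γ_F` acts on `𝔉(𝔫)` by group homomorphisms**: `σ(x +_𝔉 y) = σx +_𝔉 σy`.
[cite: FontaineAsterisque223III, Exp. II §1.2] -/
theorem gal_addPt {hθ : Function.Surjective (fontaineTheta (integerC F) p)} (σ : absoluteGaloisGroup F)
    (hσ : ∀ a : A, gal D σ (algebraMap A (AinfRamTop D) a) = algebraMap A (AinfRamTop D) a)
    (G : FormalGroup A) (x y : (nilTheta D hθ).toIdeal) :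
    gal D σ (addPt (nilTheta D hθ) G x y : AinfRamTop D) =
      (addPt (nilTheta D hθ) G ⟨gal D σ x, gal_mem_nilTheta σ x.2⟩ ⟨gal D σ y, gal_mem_nilTheta σ y.2⟩ :
        AinfRamTop D) :=
  gal_evalPt σ hσ G.toPowerSeries G.zero_constantCoeff ![x, y]
    ![⟨gal D σ x, gal_mem_nilTheta σ x.2⟩, ⟨gal D σ y, gal_mem_nilTheta σ y.2⟩]
    fun i => by fin_cases i <;> rfl

/-! ## §5 The congruence lemma: `x ≡ y (mod J)` ⇒ `f(x) ≡ f(y) (mod J)` for closed `J` -/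

/-- **Congruence lemma.** If `J` is a closed ideal of `𝔸_inf` (e.g. any ideal containing a power of `(p, ξ)`)
and `x ≡ y (mod J)` componentwise, then `f(x) ≡ f(y) (mod J)` for every power series `f` over `A`: the
partial sums agree modulo `J` and `J` is closed. [cite: CasselsFrohlichANT1967, Ch. VI §3.2] -/
theorem aeval_sub_aeval_mem {J : Ideal (AinfRamTop D)} (hJ : IsClosed (J : Set (AinfRamTop D)))
    {ι : Type*} {x y : ι → AinfRamTop D} (hx : HasEval x) (hy : HasEval y) (h : ∀ i, x i - y i ∈ J)
    (f : MvPowerSeries ι A) : aeval hx f - aeval hy f ∈ J := by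
  have h3 := (hasSum_aeval hx f).sub (hasSum_aeval hy f)
  refine hJ.mem_of_tendsto h3 (Filter.Eventually.of_forall fun s => ?_)
  refine Submodule.sum_mem _ fun d _ => ?_
  rw [← smul_sub, Algebra.smul_def]
  refine Ideal.mul_mem_left _ _ ?_
  rw [← Ideal.Quotient.eq, map_finsuppProd, map_finsuppProd]
  refine Finsupp.prod_congr fun i _ => ?_
  rw [map_pow, map_pow, Ideal.Quotient.eq.2 (h i)]

/-- Congruence lemma on points of `𝔫`. [cite: CasselsFrohlichANT1967, Ch. VI §3.2] -/
theorem evalPt_sub_evalPt_mem {hθ : Function.Surjective (fontaineTheta (integerC F) p)}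
    {J : Ideal (AinfRamTop D)} (hJ : IsClosed (J : Set (AinfRamTop D)))
    {ι : Type*} [Finite ι] (f : MvPowerSeries ι A) (hf : f.constantCoeff = 0)
    (x y : ι → (nilTheta D hθ).toIdeal) (h : ∀ i, (x i : AinfRamTop D) - y i ∈ J) :
    (evalPt (nilTheta D hθ) f hf x : AinfRamTop D) - evalPt (nilTheta D hθ) f hf y ∈ J :=
  aeval_sub_aeval_mem hJ _ _ h f

/-- **Formal-group addition is congruence-continuous**: `x ≡ x'`, `y ≡ y' (mod J)` ⇒ `x +_𝔉 y ≡ x' +_𝔉 y' (mod J)`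
for `J` closed. [cite: CasselsFrohlichANT1967, Ch. VI §3.2] -/
theorem addPt_sub_addPt_mem {hθ : Function.Surjective (fontaineTheta (integerC F) p)}
    {J : Ideal (AinfRamTop D)} (hJ : IsClosed (J : Set (AinfRamTop D)))
    (G : FormalGroup A) {x x' y y' : (nilTheta D hθ).toIdeal}
    (hx : (x : AinfRamTop D) - x' ∈ J) (hy : (y : AinfRamTop D) - y' ∈ J) :
    (addPt (nilTheta D hθ) G x y : AinfRamTop D) - addPt (nilTheta D hθ) G x' y' ∈ J :=
  evalPt_sub_evalPt_mem hJ G.toPowerSeries G.zero_constantCoeff ![x, y] ![x', y']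
    fun i => by fin_cases i <;> assumption

end EvalGal

end AinfRamTop

/-! ## §6 The discrete coefficient ring `𝒪_D` and its continuous algebras `A_inf(𝒪)`, `𝒪_{ℂ_F}` -/

namespace EisensteinRoot

/-- **The coefficient ring `𝒪_D = ℤ_p[X]/(f)` as a DISCRETE coefficient ring for power-series evaluation** (type
synonym of `D.Coeff`; as `LTCoeff` for `𝒪[F]`). [cite: CasselsFrohlichANT1967, Ch. VI §3.2] -/
def CoeffDisc : Type := D.Coeff

/-- The ring structure of `𝒪_D` on its discrete copy. [folklore] -/
instance : CommRing (CoeffDisc D) := inferInstanceAs (CommRing D.Coeff)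
/-- The discrete uniformity on the coefficient ring. [folklore] -/
instance : UniformSpace (CoeffDisc D) := ⊥
/-- The coefficient ring is discretely uniformised. [folklore] -/
instance : DiscreteUniformity (CoeffDisc D) := ⟨rfl⟩
/-- … hence discrete. [folklore] -/
instance : DiscreteTopology (CoeffDisc D) := inferInstance

/-- The identification `CoeffDisc D = 𝒪_D`. [folklore] -/
def CoeffDisc.of : D.Coeff ≃+* CoeffDisc D := RingEquiv.refl _

omit [Fact (¬ IsUnit (p : integerC F))] [IsAdicComplete (Ideal.span {(p : integerC F)}) (integerC F)] in
/-- **Every element of `𝒪_D = ℤ_p[ϖ]` has absolute value `≤ 1` in `ℂ_F`** (it is a polynomial in `ϖ` with `ℤ_p`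
coefficients; ultrametric inequality). [cite: SerreLocalFields1979, Ch. I §6 Prop. 18] -/
theorem norm_algebraMap_toF_le_one (x : D.Coeff) : ‖algebraMap F (CompletedAlgClosure F) (Coeff.toF D x)‖ ≤ 1 := by
  obtain ⟨q, rfl⟩ := AdjoinRoot.mk_surjective x
  rw [Coeff.toF, AdjoinRoot.lift_mk, Polynomial.eval₂_eq_sum_range, map_sum]
  refine IsUltrametricDist.norm_sum_le_of_forall_le_of_nonneg zero_le_one fun i _ => ?_
  rw [map_mul, map_pow, norm_mul, norm_pow]
  exact mul_le_one₀ (norm_algebraMap_zpToF_le_one hp _) (pow_nonneg (norm_nonneg _) _)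
    (pow_le_one₀ (norm_nonneg _) D.norm_algebraMap_root_le_one)

/-- **`𝒪_D → 𝒪_{ℂ_F}`** (`𝒪_D → F ⊆ ℂ_F` lands in the closed unit ball). [cite: SerreLocalFields1979, Ch. I §6 Prop. 18] -/
def CoeffDisc.toCBall : CoeffDisc D →+* CBall F :=
  ((algebraMap F (CompletedAlgClosure F)).comp ((Coeff.toF D).comp (CoeffDisc.of D).symm.toRingHom)).codRestrict (CBall F)
    fun _ => (LubinTate.mem_unitBall_iff _).2 (norm_algebraMap_toF_le_one D _)

omit [Fact (¬ IsUnit (p : integerC F))] [IsAdicComplete (Ideal.span {(p : integerC F)}) (integerC F)] in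
/-- Unfolding `toCBall` in `ℂ_F`. [cite: SerreLocalFields1979, Ch. I §6 Prop. 18] -/
theorem CoeffDisc.coe_toCBall (x : D.Coeff) :
    ((CoeffDisc.toCBall D (CoeffDisc.of D x) : CBall F) : CompletedAlgClosure F) = algebraMap F (CompletedAlgClosure F) (Coeff.toF D x) :=
  rfl

/-- **`A_inf(𝒪)` is an `𝒪_D`-algebra** through `coeffHom : 𝒪_D → A_inf(𝒪)`. [cite: FarguesFontaine2018, §1.2] -/
instance algAinfRamTop : Algebra (CoeffDisc D) (AinfRamTop D) :=
  ((AinfRamTop.of D).toRingHom.comp ((AinfRam.coeffHom D).comp (CoeffDisc.of D).symm.toRingHom)).toAlgebra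

omit [IsAdicComplete (Ideal.span {(p : integerC F)}) (integerC F)] in
/-- Unfolding the algebra map `𝒪_D → A_inf(𝒪)`. [cite: FarguesFontaine2018, §1.2] -/
theorem algebraMap_coeffDisc_ainfRamTop (x : D.Coeff) :
    algebraMap (CoeffDisc D) (AinfRamTop D) (CoeffDisc.of D x) = AinfRamTop.of D (AinfRam.coeffHom D x) := rfl

/-- The discrete coefficient ring acts continuously on `A_inf(𝒪)`. [folklore] -/
instance contSMulAinfRamTop : ContinuousSMul (CoeffDisc D) (AinfRamTop D) := by
  refine ⟨continuous_prod_of_discrete_left.mpr fun a => ?_⟩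
  change Continuous fun s : AinfRamTop D => algebraMap (CoeffDisc D) (AinfRamTop D) a * s
  exact continuous_const_mul _

/-- **`𝒪_{ℂ_F}` is an `𝒪_D`-algebra** through `𝒪_D → F ⊆ ℂ_F`. [cite: SerreLocalFields1979, Ch. I §6 Prop. 18] -/
instance algCBall : Algebra (CoeffDisc D) (CBall F) := (CoeffDisc.toCBall D).toAlgebra

omit [Fact (¬ IsUnit (p : integerC F))] [IsAdicComplete (Ideal.span {(p : integerC F)}) (integerC F)] in
/-- Unfolding the algebra map `𝒪_D → 𝒪_{ℂ_F}`. [cite: SerreLocalFields1979, Ch. I §6 Prop. 18] -/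
theorem coe_algebraMap_coeffDisc_cBall (x : D.Coeff) :
    ((algebraMap (CoeffDisc D) (CBall F) (CoeffDisc.of D x) : CBall F) : CompletedAlgClosure F) =
      algebraMap F (CompletedAlgClosure F) (Coeff.toF D x) := rfl

/-- The discrete coefficient ring acts continuously on `𝒪_{ℂ_F}`. [folklore] -/
instance contSMulCBall : ContinuousSMul (CoeffDisc D) (CBall F) := by
  refine ⟨continuous_prod_of_discrete_left.mpr fun a => ?_⟩
  change Continuous fun s : CBall F => algebraMap (CoeffDisc D) (CBall F) a * s
  exact continuous_const_mul _

/-- **`θ_𝒪` is compatible with the `𝒪_D`-structures**: `θ_𝒪(a · 1) = a · 1` — the hypothesis `hA` of §4 for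
`𝒪_D`-coefficients. [cite: FarguesFontaine2018, §2.2] -/
theorem theta_algebraMap_coeffDisc (a : CoeffDisc D) :
    AinfRamTop.theta D (algebraMap (CoeffDisc D) (AinfRamTop D) a) = algebraMap (CoeffDisc D) (CBall F) a := by
  obtain ⟨x, rfl⟩ := (CoeffDisc.of D).surjective a
  apply Subtype.ext
  rw [algebraMap_coeffDisc_ainfRamTop, AinfRamTop.coe_theta, AinfRam.coe_theta_coeffHom, coe_algebraMap_coeffDisc_cBall]

omit [IsAdicComplete (Ideal.span {(p : integerC F)}) (integerC F)] in
/-- **`Γ_F` fixes the `𝒪_D`-structure of `A_inf(𝒪)`**: `σ(a · 1) = a · 1` — the hypothesis `hσ` of §4 for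
`𝒪_D`-coefficients. [cite: FontaineAsterisque223III, Exp. II §1.2] -/
theorem gal_algebraMap_coeffDisc (σ : absoluteGaloisGroup F) (a : CoeffDisc D) :
    AinfRamTop.gal D σ (algebraMap (CoeffDisc D) (AinfRamTop D) a) = algebraMap (CoeffDisc D) (AinfRamTop D) a := by
  obtain ⟨x, rfl⟩ := (CoeffDisc.of D).surjective a
  rw [algebraMap_coeffDisc_ainfRamTop, AinfRamTop.gal_of, AinfRam.gal_coeffHom]

/-- **`θ_𝒪 : 𝔉(𝔫_𝒪) → 𝔉(𝔪_{ℂ_F})` is a homomorphism for every formal group law `𝔉` over `𝒪_D`** (§4 with `hA`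
discharged). [cite: CasselsFrohlichANT1967, Ch. VI §3.2] -/
theorem theta_addPt_coeffDisc {hθ : Function.Surjective (fontaineTheta (integerC F) p)} (G : FormalGroup (CoeffDisc D))
    (x y : (AinfRamTop.nilTheta D hθ).toIdeal) :
    AinfRamTop.theta D (addPt (AinfRamTop.nilTheta D hθ) G x y : AinfRamTop D) =
      (addPt (maxNilIdealC F) G ⟨AinfRamTop.theta D x, AinfRamTop.theta_mem_maxNilIdealC x.2⟩
        ⟨AinfRamTop.theta D y, AinfRamTop.theta_mem_maxNilIdealC y.2⟩ : CBall F) :=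
  AinfRamTop.theta_addPt (theta_algebraMap_coeffDisc D) G x y

/-- **`Γ_F` acts on `𝔉(𝔫_𝒪)` by group homomorphisms for every formal group law `𝔉` over `𝒪_D`** (§4 with `hσ`
discharged). [cite: FontaineAsterisque223III, Exp. II §1.2] -/
theorem gal_addPt_coeffDisc {hθ : Function.Surjective (fontaineTheta (integerC F) p)} (σ : absoluteGaloisGroup F)
    (G : FormalGroup (CoeffDisc D)) (x y : (AinfRamTop.nilTheta D hθ).toIdeal) :
    AinfRamTop.gal D σ (addPt (AinfRamTop.nilTheta D hθ) G x y : AinfRamTop D) =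
      (addPt (AinfRamTop.nilTheta D hθ) G ⟨AinfRamTop.gal D σ x, AinfRamTop.gal_mem_nilTheta σ x.2⟩
        ⟨AinfRamTop.gal D σ y, AinfRamTop.gal_mem_nilTheta σ y.2⟩ : AinfRamTop D) :=
  AinfRamTop.gal_addPt σ (gal_algebraMap_coeffDisc D σ) G x y

end EisensteinRoot

end Literature.NumberTheory.PAdicHodge

end
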